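import Literature.Analysis.FluidPDE.CylinderPairings
import Literature.Analysis.FunctionSpaces.DiagonalWeakLimits
import HarnessLib

/-!
# Pairings of distributional Navier–Stokes solutions on a cylinder: continuous representatives,
equicontinuity, and a common subsequence along which all pairings converge for a.e. time

Analysis/FluidPDE support file (theorems only), second of three files proving the strong `L²`
compactness of velocities on a cylinder `W = (a, b) × B_R(x₀)` (Temam 1977, Ch. III, Thm. 2.1;
Lin 1998, Thm. 2.2; Bradshaw–Tsai 2019, §4.3), continuing `CylinderPairings.lean`.

For a sequence `(vₖ, πₖ)` of distributional solutions on `W` with the uniform bounds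
`ess sup_t ∫_B |vₖ(t)|² ≤ C` and `∬_W |πₖ|^{3/2} ≤ C`, and a **countable** family of test fields
`ηᵢ ∈ C_c^∞(B_R(x₀); ℝ³)`, there is one subsequence `σ` along which every pairing
`t ↦ ∫_B ⟪v_{σ(j)}(t), ηᵢ⟫` converges for a.e. `t ∈ (a, b)`
(`exists_subseq_forall_ae_tendsto_pairing`). Proof (Temam 1977, Ch. III, §2, proof of Thm. 2.1 /
(2.35)–(2.37); Leray 1934, §13 "procédé diagonal"): by du Bois-Reymond
(`exists_ae_eq_const_add_primitive`) each pairing agrees a.e. with the continuous primitive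
`Vₖᵢ(t) = c + ∫ₐᵗ fₖᵢ` of the tested remainder; the bounds of `CylinderPairings.lean` make the
`Vₖᵢ` uniformly bounded and uniformly equicontinuous in `k` (modulus `A δ + A' δ^{1/3}` from the
`L^{3/2}` pressure bound); Cantor's diagonal procedure at rational times
(`exists_strictMono_forall_tendsto_real`) and equicontinuity
(`forall_exists_tendsto_of_subset_closure`) give convergence at every time.

## References

* R. Temam, *Navier–Stokes equations* (1977), Ch. III, §2, Thm. 2.1. [Temam1977]
* J. Leray, Acta Math. 63 (1934), §13.
* F. Lin, CPAM 51 (1998), Thm. 2.2. [Lin1998]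
-/

noncomputable section

open MeasureTheory Set Function Filter Topology TopologicalSpace Metric intervalIntegral
open scoped NNReal ENNReal InnerProductSpace RealInnerProductSpace Laplacian

namespace Literature.Analysis.FluidPDE

/-! ### Real-variable lemmas: primitives on `[a, b]` -/

section Primitive

variable {a b : ℝ}

/-- A continuous function on `(a, b)` which is a.e. bounded by `M` is everywhere bounded by `M`
there (an open null set is empty). [folklore] -/
theorem norm_le_of_ae_norm_le_of_continuousOn {F : Type*} [NormedAddCommGroup F] {V : ℝ → F}
    {M : ℝ} (hV : ContinuousOn V (Ioo a b))
    (h : ∀ᵐ t ∂((volume : Measure ℝ).restrict (Ioo a b)), ‖V t‖ ≤ M) :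
    ∀ t ∈ Ioo a b, ‖V t‖ ≤ M := by
  have hU : IsOpen (Ioo a b ∩ V ⁻¹' {y | M < ‖y‖}) :=
    hV.isOpen_inter_preimage isOpen_Ioo (isOpen_lt continuous_const continuous_norm)
  have hU0 : volume (Ioo a b ∩ V ⁻¹' {y | M < ‖y‖}) = 0 := by
    rw [ae_restrict_iff' measurableSet_Ioo] at h
    rw [measure_eq_zero_iff_ae_notMem]
    filter_upwards [h] with t ht hmem
    exact (not_lt.2 (ht hmem.1)) hmem.2
  have hUe := (hU.measure_eq_zero_iff volume).1 hU0
  intro t ht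
  by_contra hlt
  have hmem : t ∈ Ioo a b ∩ V ⁻¹' {y | M < ‖y‖} := ⟨ht, not_le.1 hlt⟩
  rw [hUe] at hmem
  exact hmem

/-- Increments of the primitive `t ↦ c + ∫_{(a,t]} f` of an integrable `f` on `(a, b)`:
`V t - V s = ∫_{(s,t]} f` for `a ≤ s ≤ t ≤ b`. [folklore] -/
theorem const_add_primitive_sub_eq {f : ℝ → ℝ} (hf : IntegrableOn f (Ioo a b) volume) (c : ℝ)
    {s t : ℝ} (hs : a ≤ s) (hst : s ≤ t) (ht : t ≤ b) :
    (c + ∫ τ in Ioc a t, f τ) - (c + ∫ τ in Ioc a s, f τ) = ∫ τ in Ioc s t, f τ := by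
  have hfI : IntegrableOn f (Icc a b) volume :=
    (integrableOn_Icc_iff_integrableOn_Ioo (by simp) (by simp)).2 hf
  have hii : ∀ {x y : ℝ}, a ≤ x → x ≤ y → y ≤ b → IntervalIntegrable f volume x y := by
    intro x y hx hxy hy
    rw [intervalIntegrable_iff_integrableOn_Icc_of_le hxy]
    exact hfI.mono_set (Icc_subset_Icc hx hy)
  rw [add_sub_add_left_eq_sub, ← integral_of_le (hs.trans hst), ← integral_of_le hs,
    ← integral_of_le hst]
  exact integral_interval_sub_left (hii le_rfl (hs.trans hst) ht) (hii le_rfl hs (hst.trans ht))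

/-- The primitive `t ↦ c + ∫_{(a,t]} f` of an integrable `f` on `(a, b)` is continuous on
`[a, b]`. [folklore] -/
theorem continuousOn_const_add_primitive {f : ℝ → ℝ} (hf : IntegrableOn f (Ioo a b) volume)
    (c : ℝ) : ContinuousOn (fun t => c + ∫ τ in Ioc a t, f τ) (Icc a b) :=
  continuousOn_const.add (intervalIntegral.continuousOn_primitive
    ((integrableOn_Icc_iff_integrableOn_Ioo (by simp) (by simp)).2 hf))

/-- **Norm of an increment of a primitive**: `‖V t - V s‖ₑ ≤ ∫⁻_{(s,t]} ‖f‖ₑ`. [folklore] -/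
theorem enorm_const_add_primitive_sub_le {f : ℝ → ℝ} (hf : IntegrableOn f (Ioo a b) volume)
    (c : ℝ) {s t : ℝ} (hs : a ≤ s) (hst : s ≤ t) (ht : t ≤ b) :
    ‖(c + ∫ τ in Ioc a t, f τ) - (c + ∫ τ in Ioc a s, f τ)‖ₑ ≤ ∫⁻ τ in Ioc s t, ‖f τ‖ₑ := by
  rw [const_add_primitive_sub_eq hf c hs hst ht]
  exact enorm_integral_le_lintegral_enorm _

end Primitive

/-- **The equicontinuity modulus tends to zero**: `A₀ δ + A₁ (δ V₀)^{1/3} → 0` as `δ → 0` (finite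
constants). [folklore] -/
theorem tendsto_linear_add_cubeRoot_modulus {A₀ A₁ V₀ : ℝ≥0∞} (hA₀ : A₀ ≠ ∞) (hA₁ : A₁ ≠ ∞)
    (hV₀ : V₀ ≠ ∞) :
    Tendsto (fun δ : ℝ => A₀ * ENNReal.ofReal δ + A₁ * (ENNReal.ofReal δ * V₀) ^ (1 / 3 : ℝ))
      (𝓝 0) (𝓝 0) := by
  have h0 : Tendsto (fun δ : ℝ => ENNReal.ofReal δ) (𝓝 0) (𝓝 0) := by
    have := ENNReal.tendsto_ofReal (tendsto_id (x := 𝓝 (0 : ℝ)))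
    simpa using this
  have h1 : Tendsto (fun δ : ℝ => A₀ * ENNReal.ofReal δ) (𝓝 0) (𝓝 0) := by
    simpa using ENNReal.Tendsto.const_mul h0 (Or.inr hA₀)
  have h2 : Tendsto (fun δ : ℝ => (ENNReal.ofReal δ * V₀) ^ (1 / 3 : ℝ)) (𝓝 0) (𝓝 0) := by
    have h3 : Tendsto (fun δ : ℝ => ENNReal.ofReal δ * V₀) (𝓝 0) (𝓝 0) := by
      simpa using ENNReal.Tendsto.mul_const h0 (Or.inr hV₀)
    have h4 := ((ENNReal.continuous_rpow_const (y := (1 / 3 : ℝ))).tendsto 0).comp h3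
    rw [ENNReal.zero_rpow_of_pos (by norm_num)] at h4
    exact h4
  have h5 : Tendsto (fun δ : ℝ => A₁ * (ENNReal.ofReal δ * V₀) ^ (1 / 3 : ℝ)) (𝓝 0) (𝓝 0) := by
    simpa using ENNReal.Tendsto.const_mul h2 (Or.inr hA₁)
  simpa using h1.add h5

/-! ### A common subsequence along which all pairings converge for a.e. time -/

section Extraction

variable {x₀ : EuclideanSpace ℝ (Fin 3)} {R a b ν : ℝ}
  {v : ℕ → ℝ → EuclideanSpace ℝ (Fin 3) → EuclideanSpace ℝ (Fin 3)}
  {π : ℕ → ℝ → EuclideanSpace ℝ (Fin 3) → ℝ}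

/-- **Diagonal extraction for the pairings of a bounded sequence of distributional solutions on a
cylinder.** Let `(vₖ, πₖ)` be distributional solutions of the Navier–Stokes equations (viscosity
`ν`, no force) on `W = (a, b) × B_R(x₀)`, `a < b`, with `∫_B |vₖ(t)|² ≤ C` for a.e. `t` and
`∬_W |πₖ|^{3/2} ≤ C` for all `k`, and let `(ηᵢ)` be a countable family of test fields on the ball.
Then along one subsequence `σ` every pairing `t ↦ ∫_B ⟪v_{σ(j)}(t), ηᵢ⟫` converges for a.e.
`t ∈ (a, b)` (Temam 1977, Ch. III, §2, proof of Thm. 2.1: continuous representatives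
`c + ∫ₐᵗ f`, uniform bound and equicontinuity from the bounds, Cantor diagonal procedure at
rational times, equicontinuity at all times). [cite: Temam1977, Ch. III §2 Thm. 2.1 (proof)] -/
theorem exists_subseq_forall_ae_tendsto_pairing {C : ℝ≥0}
    (hsol : ∀ k, IsDistributionalNSSolutionOn (timeCylinder
      (⟨ball x₀ R, isOpen_ball⟩ : Opens (EuclideanSpace ℝ (Fin 3))) a b) ν 0 (v k) (π k))
    (hE : ∀ k, ∀ᵐ t ∂((volume : Measure ℝ).restrict (Ioo a b)),
      ∫⁻ x in ball x₀ R, ‖v k t x‖ₑ ^ 2 ≤ C)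
    (hP : ∀ k, ∫⁻ z in Ioo a b ×ˢ ball x₀ R, ‖π k z.1 z.2‖ₑ ^ (3 / 2 : ℝ) ≤ C)
    {ι : Type*} [Countable ι] {η : ι → EuclideanSpace ℝ (Fin 3) → EuclideanSpace ℝ (Fin 3)}
    (hη : ∀ i, FunctionSpaces.IsTestFunctionOn
      (⟨ball x₀ R, isOpen_ball⟩ : Opens (EuclideanSpace ℝ (Fin 3))) (η i)) :
    ∃ σ : ℕ → ℕ, StrictMono σ ∧ ∀ i, ∀ᵐ t ∂((volume : Measure ℝ).restrict (Ioo a b)),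
      ∃ l : ℝ, Tendsto (fun j => ∫ x in ball x₀ R, ⟪v (σ j) t x, η i x⟫) atTop (𝓝 l) := by
  set B : Set (EuclideanSpace ℝ (Fin 3)) := ball x₀ R with hB
  haveI : IsFiniteMeasure ((volume : Measure (ℝ × EuclideanSpace ℝ (Fin 3))).restrict (Ioo a b ×ˢ B)) :=
    isFiniteMeasure_restrict_cylinder a b x₀ R
  have hBtop : volume B ≠ ∞ := measure_ball_lt_top.ne
  have hIoo : volume (Ioo a b) < ∞ := by rw [Real.volume_Ioo]; exact ENNReal.ofReal_lt_top
  -- ## integrability classes on the cylinder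
  have hmv : ∀ k, AEStronglyMeasurable (uncurry (v k))
      ((volume : Measure (ℝ × EuclideanSpace ℝ (Fin 3))).restrict (Ioo a b ×ˢ B)) :=
    fun k => (hsol k).1.aestronglyMeasurable
  have hmπ : ∀ k, AEStronglyMeasurable (uncurry (π k))
      ((volume : Measure (ℝ × EuclideanSpace ℝ (Fin 3))).restrict (Ioo a b ×ˢ B)) :=
    fun k => (hsol k).2.2.1.aestronglyMeasurable
  have hv2 : ∀ k, MemLp (uncurry (v k)) 2
      ((volume : Measure (ℝ × EuclideanSpace ℝ (Fin 3))).restrict (Ioo a b ×ˢ B)) := fun k =>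
    memLp_two_of_aestronglyMeasurable_of_lintegral_sq_lt_top (hmv k)
      (lt_of_le_of_lt (setLIntegral_cylinder_enorm_sq_le (hmv k) (hE k))
        (ENNReal.mul_lt_top ENNReal.coe_lt_top hIoo))
  have hπ1 : ∀ k, Integrable (uncurry (π k))
      ((volume : Measure (ℝ × EuclideanSpace ℝ (Fin 3))).restrict (Ioo a b ×ˢ B)) := fun k => by
    refine ⟨hmπ k, ?_⟩
    refine lt_of_le_of_lt (setLIntegral_enorm_le_of_three_halves (μ := volume) (S := Ioo a b ×ˢ B)
      (p := uncurry (π k)) (hmπ k)) (ENNReal.mul_lt_top ?_ ?_)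
    · exact ENNReal.rpow_lt_top_of_nonneg (by norm_num) (volume_cylinder_lt_top a b x₀ R).ne
    · exact ENNReal.rpow_lt_top_of_nonneg (by norm_num) (ne_top_of_le_ne_top ENNReal.coe_ne_top (hP k))
  -- ## pairings, remainders, continuous representatives
  set g : ℕ → ι → ℝ → ℝ := fun k i t => ∫ x in B, ⟪v k t x, η i x⟫ with hg
  set f : ℕ → ι → ℝ → ℝ := fun k i t => ∫ x in B, (⟪v k t x, fderiv ℝ (η i) x (v k t x)⟫ +
    ν * ⟪v k t x, Δ (η i) x⟫ + π k t x * VectorCalculus.divergence (η i) x) with hf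
  have hgf : ∀ k i, IntegrableOn (g k i) (Ioo a b) volume ∧ IntegrableOn (f k i) (Ioo a b) volume :=
    fun k i => integrableOn_pairing_cylinder (ν := ν) (hv2 k) (hπ1 k) (hη i)
  have hc' : ∀ k i, ∃ c : ℝ, ∀ᵐ t ∂((volume : Measure ℝ).restrict (Ioo a b)),
      g k i t = c + ∫ s in Ioc a t, f k i s := fun k i =>
    exists_ae_eq_const_add_primitive (hgf k i).1 (hgf k i).2 fun χ hχ hχc hχI =>
      (hsol k).setIntegral_deriv_mul_pairing_add_eq_zero_cylinder (hv2 k) (hπ1 k) hχ hχc hχI (hη i)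
  choose c hc using hc'
  set V : ℕ → ι → ℝ → ℝ := fun k i t => c k i + ∫ s in Ioc a t, f k i s with hV
  have hVc : ∀ k i, ContinuousOn (V k i) (Icc a b) := fun k i =>
    continuousOn_const_add_primitive (hgf k i).2 _
  -- ## constants and uniform bounds
  have hK : ∀ i, ∃ K₀ K₁ K₂ : ℝ, (∀ x, ‖η i x‖ ≤ K₀) ∧ (∀ x, ‖fderiv ℝ (η i) x‖ ≤ K₁) ∧
      ∀ x, ‖Δ (η i) x‖ ≤ K₂ := fun i => exists_bounds_of_isTestFunctionOn (hη i)
  choose K₀ K₁ K₂ hK₀ hK₁ hK₂ using hK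
  set M : ι → ℝ≥0∞ := fun i => ENNReal.ofReal (K₀ i) * (volume B + C) with hM
  have hMtop : ∀ i, M i ≠ ∞ := fun i =>
    ENNReal.mul_ne_top ENNReal.ofReal_ne_top (ENNReal.add_ne_top.2 ⟨hBtop, ENNReal.coe_ne_top⟩)
  have hgM : ∀ k i, ∀ᵐ t ∂((volume : Measure ℝ).restrict (Ioo a b)), ‖g k i t‖ₑ ≤ M i :=
    fun k i => ae_enorm_pairing_le (hE k) (hK₀ i)
  have hVM : ∀ k i, ∀ t ∈ Ioo a b, ‖V k i t‖ ≤ (M i).toReal := fun k i =>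
    norm_le_of_ae_norm_le_of_continuousOn ((hVc k i).mono Ioo_subset_Icc_self) (by
      filter_upwards [hc k i, hgM k i] with t h1 h2
      have e : V k i t = g k i t := h1.symm
      rw [e, ← toReal_enorm]
      exact ENNReal.toReal_mono (hMtop i) h2)
  set A₀ : ι → ℝ≥0∞ := fun i =>
    ENNReal.ofReal (K₁ i) * C + ENNReal.ofReal (|ν| * K₂ i) * (volume B + C) with hA₀
  set A₁ : ι → ℝ≥0∞ := fun i => ENNReal.ofReal (3 * K₁ i) * (C : ℝ≥0∞) ^ (2 / 3 : ℝ) with hA₁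
  have hA₀top : ∀ i, A₀ i ≠ ∞ := fun i => ENNReal.add_ne_top.2
    ⟨ENNReal.mul_ne_top ENNReal.ofReal_ne_top ENNReal.coe_ne_top,
      ENNReal.mul_ne_top ENNReal.ofReal_ne_top (ENNReal.add_ne_top.2 ⟨hBtop, ENNReal.coe_ne_top⟩)⟩
  have hA₁top : ∀ i, A₁ i ≠ ∞ := fun i => ENNReal.mul_ne_top ENNReal.ofReal_ne_top
    (ENNReal.rpow_ne_top_of_nonneg (by norm_num) ENNReal.coe_ne_top)
  have hfbd : ∀ k i, ∀ᵐ τ ∂((volume : Measure ℝ).restrict (Ioo a b)),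
      ‖f k i τ‖ₑ ≤ A₀ i + ENNReal.ofReal (3 * K₁ i) * ∫⁻ x in B, ‖π k τ x‖ₑ :=
    fun k i => ae_enorm_remainder_le (hmv k) (hmπ k) (hE k) (hK₁ i) (hK₂ i)
  -- the equicontinuity modulus
  have hmod : ∀ k i {s t : ℝ}, a ≤ s → s ≤ t → t ≤ b →
      ‖V k i t - V k i s‖ₑ ≤ A₀ i * ENNReal.ofReal (t - s) +
        A₁ i * (ENNReal.ofReal (t - s) * volume B) ^ (1 / 3 : ℝ) := by
    intro k i s t hs hst ht
    have hae : ∀ᵐ τ ∂((volume : Measure ℝ).restrict (Ioc s t)),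
        ‖f k i τ‖ₑ ≤ A₀ i + ENNReal.ofReal (3 * K₁ i) * ∫⁻ x in B, ‖π k τ x‖ₑ := by
      rw [← Measure.restrict_congr_set Ioo_ae_eq_Ioc]
      exact ae_restrict_of_ae_restrict_of_subset (Ioo_subset_Ioo hs ht) (hfbd k i)
    calc ‖V k i t - V k i s‖ₑ ≤ ∫⁻ τ in Ioc s t, ‖f k i τ‖ₑ :=
          enorm_const_add_primitive_sub_le (hgf k i).2 _ hs hst ht
      _ ≤ ∫⁻ τ in Ioc s t, (A₀ i + ENNReal.ofReal (3 * K₁ i) * ∫⁻ x in B, ‖π k τ x‖ₑ) :=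
          lintegral_mono_ae hae
      _ = A₀ i * volume (Ioc s t) +
            ENNReal.ofReal (3 * K₁ i) * ∫⁻ τ in Ioc s t, ∫⁻ x in B, ‖π k τ x‖ₑ := by
          rw [lintegral_add_left measurable_const, lintegral_const, Measure.restrict_apply_univ,
            mul_comm, lintegral_const_mul' _ _ ENNReal.ofReal_ne_top]
      _ ≤ A₀ i * ENNReal.ofReal (t - s) + ENNReal.ofReal (3 * K₁ i) *
            ((volume (Ioo s t) * volume B) ^ (1 / 3 : ℝ) * (C : ℝ≥0∞) ^ (2 / 3 : ℝ)) := by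
          rw [Real.volume_Ioc]
          gcongr
          exact setLIntegral_Ioc_pressure_le (hmπ k) (hP k) hs ht
      _ = A₀ i * ENNReal.ofReal (t - s) + A₁ i * (ENNReal.ofReal (t - s) * volume B) ^ (1 / 3 : ℝ) := by
          rw [Real.volume_Ioo, hA₁]
          ring
  -- ## diagonal extraction at rational times
  set D : Set ℝ := Ioo a b ∩ range ((↑) : ℚ → ℝ) with hD
  have hDc : D.Countable := (countable_range _).mono inter_subset_right
  have hDsub : Ioo a b ⊆ closure D := Rat.denseRange_cast.open_subset_closure_inter isOpen_Ioo
  haveI : Countable D := hDc.to_subtype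
  obtain ⟨σ, hσ, hlim⟩ := FunctionSpaces.exists_strictMono_forall_tendsto_real
    (fun n (q : ι × D) => V n q.1 (q.2 : ℝ)) (fun q => ⟨(M q.1).toReal, fun n => by
      rw [← Real.norm_eq_abs]; exact hVM n q.1 _ q.2.2.1⟩)
  refine ⟨σ, hσ, fun i => ?_⟩
  -- ## convergence at every time by equicontinuity
  have hall : ∀ t ∈ Ioo a b, ∃ l, Tendsto (fun n => V (σ n) i t) atTop (𝓝 l) := by
    refine FunctionSpaces.forall_exists_tendsto_of_subset_closure
      (x := fun n t => V (σ n) i t) (S := Ioo a b) (D := D) hDsub ?_ ?_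
    · rintro d ⟨hd, q, rfl⟩
      exact hlim (i, ⟨(q : ℝ), ⟨hd, q, rfl⟩⟩)
    · intro ε hε
      have hω := tendsto_linear_add_cubeRoot_modulus (hA₀top i) (hA₁top i) hBtop
      have hev := hω.eventually_lt_const (ENNReal.ofReal_pos.2 hε)
      obtain ⟨δ, hδ, hδε⟩ := Metric.eventually_nhds_iff.1 hev
      refine ⟨δ, hδ, fun n t ht d hd htd => ?_⟩
      -- order the two times
      have key : ∀ {s u : ℝ}, s ∈ Ioo a b → u ∈ Ioo a b → s ≤ u → dist s u < δ →
          dist (V (σ n) i u) (V (σ n) i s) < ε := by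
        intro s u hs hu hsu hdist
        have h1 := hmod (σ n) i (le_of_lt hs.1) hsu (le_of_lt hu.2)
        have hus : dist (u - s) 0 < δ := by
          rwa [dist_zero_right, Real.norm_eq_abs, abs_of_nonneg (sub_nonneg.2 hsu), ← abs_of_nonneg
            (sub_nonneg.2 hsu), ← Real.dist_eq, dist_comm]
        have h2 := hδε hus
        have h3 : ‖V (σ n) i u - V (σ n) i s‖ₑ < ENNReal.ofReal ε := lt_of_le_of_lt h1 h2
        rw [← ofReal_norm, ENNReal.ofReal_lt_ofReal_iff hε] at h3
        rwa [dist_eq_norm]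
      rcases le_total t d with htd' | hdt'
      · rw [dist_comm]
        exact key ht hd.1 htd' htd
      · exact key hd.1 ht hdt' (by rwa [dist_comm])
  -- ## back to the pairings, a.e.
  have hae : ∀ᵐ t ∂((volume : Measure ℝ).restrict (Ioo a b)), ∀ n, g (σ n) i t = V (σ n) i t := by
    rw [ae_all_iff]
    intro n
    exact hc (σ n) i
  filter_upwards [hae, ae_restrict_mem measurableSet_Ioo] with t h1 h2
  obtain ⟨l, hl⟩ := hall t h2
  exact ⟨l, hl.congr fun n => (h1 n).symm⟩

end Extraction

end Literature.Analysis.FluidPDE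

end
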